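import Summits.NavierStokesRegularity.NavierStokesRegularity.Theorems.PlaneEnergyCeilingPlanarEnergyAPrioriSmallDataInequalities
import HarnessLib

/-!
# Small planar data: the bootstrap, I — self-improvement of the two scale-invariant bounds

Route `PlaneEnergyCeiling`, crux `PlanarEnergyAPriori` (stmt-NavierStokesRegularity-16855), small-data
corner, third tool file. Abstract setting: a continuous field `v` on `ℝ × ℝ³` (`ν = 1`), jointly
measurable, bounded by `D`, with planar energies bounded by `X_ap²` on every slice (a priori, crude),
which solves the Oseen integral equation `v(t) = e^{(t−t₀)Δ}v(t₀) − B_{t₀}(v,v)(t)` from every base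
time `0 ≤ t₀ < t ≤ S₁`. **Theorem (`planar_small_propagation`).** There are absolute `ε* > 0` and
`c* > 0` such that if the initial slice has planar energies `≤ ε²` with `0 < ε ≤ ε*`, then every slice
`v(t)`, `0 < t ≤ S₁`, has planar energies `≤ (2ε)²` and `√t ‖v(t)‖_∞ ≤ c*`.

Proof (continuity method on the two scale-invariant quantities `X(t) = sup_planes ‖v(t)‖_{L²}` and
`Φ(t) = √t ‖v(t)‖_∞`): with the inequalities of `SmallDataInequalities.lean` from the base time `0`,
the bounds `X ≤ 2ε`, `Φ ≤ η` on `(0, τ]` improve themselves to `X ≤ 3ε/2`, `Φ ≤ η/2`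
(`improve_planar`, `improve_sup`; the time integrals are `∫₀ᵗ (t−s)^{-1/2}s^{-1/2} ds ≤ 4√2` and
`∫₀ᵗ (const + (t−s)^{-1/2}) ds`); from the base time `τ` with the crude bounds `D`, `X_ap` they
persist a little beyond `τ` (`slack`); and they pass to limits `τ' ↑ τ` by Fatou and continuity
(`closed`); the first exit time therefore does not exist.

## References

* G. Koch, N. Nadirashvili, G. Seregin, V. Šverák, Acta Math. 203 (2009), §4 (arXiv:0709.3599).
  [KochNadirashviliSereginSverak2009]
* T. Kato, *Strong `L^p` solutions of the Navier–Stokes equation in `ℝ^m`*, Math. Z. 187 (1984)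
  (the small-data continuity method). [Kato1984]
-/

noncomputable section

-- single-conjunct summit: `Summit.<Summit>.<Problem>` repeats the name by the D-0017 layout
set_option linter.dupNamespace false

namespace Summit.NavierStokesRegularity.NavierStokesRegularity.Theorems.PlanarEnergyAPriori.SmallData

open MeasureTheory Set Function Filter Topology TopologicalSpace Metric WithLp
open scoped NNReal ENNReal
open Literature.Analysis Literature.Analysis.FluidPDE Literature.Analysis.FunctionSpaces

/-! ### Two elementary time integrals -/

/-- `s ↦ s^{-1/2}` is integrable on `(0, t)`. [folklore] -/
theorem integrableOn_rpow_neg_half_Ioo (t : ℝ) :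
    IntegrableOn (fun s : ℝ => s ^ (-(1 / 2 : ℝ))) (Ioo 0 t) := by
  rcases le_or_gt t 0 with ht | ht
  · rw [Ioo_eq_empty (not_lt.2 ht)]
    exact integrableOn_empty
  have h := (intervalIntegral.intervalIntegrable_rpow' (by norm_num : (-1 : ℝ) < -(1 / 2 : ℝ))
    (a := 0) (b := t)).1
  exact h.mono_set Ioo_subset_Ioc_self

/-- `∫₀ᵗ s^{-1/2} ds = 2 t^{1/2}` for `t ≥ 0`. [folklore] -/
theorem setIntegral_Ioo_rpow_neg_half {t : ℝ} (ht : 0 ≤ t) :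
    ∫ s in Ioo 0 t, s ^ (-(1 / 2 : ℝ)) = 2 * t ^ (1 / 2 : ℝ) := by
  rw [← integral_Ioc_eq_integral_Ioo, ← intervalIntegral.integral_of_le ht,
    integral_rpow (Or.inl (by norm_num))]
  have h1 : (-(1 / 2 : ℝ)) + 1 = 1 / 2 := by norm_num
  rw [h1, Real.zero_rpow (by norm_num), sub_zero]
  ring

/-- **The Beta-type integral, crudely**: `s ↦ (t−s)^{-1/2} s^{-1/2}` is integrable on `(0,t)` and
`∫₀ᵗ (t−s)^{-1/2} s^{-1/2} ds ≤ 4√2` (`t > 0`; the exact value is `π`): on each half of the interval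
one factor is at most `(t/2)^{-1/2}`. [folklore] -/
theorem integrableOn_and_setIntegral_beta_le {t : ℝ} (ht : 0 < t) :
    IntegrableOn (fun s : ℝ => (t - s) ^ (-(1 / 2 : ℝ)) * s ^ (-(1 / 2 : ℝ))) (Ioo 0 t) ∧
      ∫ s in Ioo 0 t, (t - s) ^ (-(1 / 2 : ℝ)) * s ^ (-(1 / 2 : ℝ)) ≤ 4 * Real.sqrt 2 := by
  set a : ℝ := (t / 2) ^ (-(1 / 2 : ℝ)) with ha
  have ha0 : 0 < a := Real.rpow_pos_of_pos (by positivity) _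
  -- the dominating function
  set G : ℝ → ℝ := fun s => a * (s ^ (-(1 / 2 : ℝ)) + (t - s) ^ (-(1 / 2 : ℝ))) with hG
  have hGi : IntegrableOn G (Ioo 0 t) :=
    ((integrableOn_rpow_neg_half_Ioo t).add (integrableOn_sub_rpow_Ioo (by norm_num))).const_mul a
  have hdom : ∀ s ∈ Ioo 0 t, (t - s) ^ (-(1 / 2 : ℝ)) * s ^ (-(1 / 2 : ℝ)) ≤ G s := by
    intro s hs
    have hs1 : 0 < s := hs.1
    have hs2 : 0 < t - s := sub_pos.2 hs.2
    have h1 : 0 ≤ s ^ (-(1 / 2 : ℝ)) := Real.rpow_nonneg hs1.le _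
    have h2 : 0 ≤ (t - s) ^ (-(1 / 2 : ℝ)) := Real.rpow_nonneg hs2.le _
    rcases le_or_gt s (t / 2) with hle | hgt
    · -- `t - s ≥ t/2`
      have h3 : (t - s) ^ (-(1 / 2 : ℝ)) ≤ a :=
        Real.rpow_le_rpow_of_nonpos (by positivity) (by linarith) (by norm_num)
      calc (t - s) ^ (-(1 / 2 : ℝ)) * s ^ (-(1 / 2 : ℝ)) ≤ a * s ^ (-(1 / 2 : ℝ)) :=
            mul_le_mul_of_nonneg_right h3 h1
        _ ≤ G s := by rw [hG]; nlinarith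
    · -- `s ≥ t/2`
      have h3 : s ^ (-(1 / 2 : ℝ)) ≤ a :=
        Real.rpow_le_rpow_of_nonpos (by positivity) hgt.le (by norm_num)
      calc (t - s) ^ (-(1 / 2 : ℝ)) * s ^ (-(1 / 2 : ℝ)) ≤ (t - s) ^ (-(1 / 2 : ℝ)) * a :=
            mul_le_mul_of_nonneg_left h3 h2
        _ ≤ G s := by rw [hG]; nlinarith
  have hmeas : AEStronglyMeasurable (fun s : ℝ => (t - s) ^ (-(1 / 2 : ℝ)) * s ^ (-(1 / 2 : ℝ)))
      (volume.restrict (Ioo 0 t)) := by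
    refine ContinuousOn.aestronglyMeasurable (fun s hs => ?_) measurableSet_Ioo
    have hs1 : 0 < s := hs.1
    have hs2 : 0 < t - s := sub_pos.2 hs.2
    exact ((continuousAt_const.sub continuousAt_id).rpow_const (Or.inl hs2.ne')).mul
      (continuousAt_id.rpow_const (Or.inl hs1.ne')) |>.continuousWithinAt
  have hnn : ∀ s ∈ Ioo 0 t, 0 ≤ (t - s) ^ (-(1 / 2 : ℝ)) * s ^ (-(1 / 2 : ℝ)) := fun s hs =>
    mul_nonneg (Real.rpow_nonneg (sub_pos.2 hs.2).le _) (Real.rpow_nonneg hs.1.le _)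
  have hint : IntegrableOn (fun s : ℝ => (t - s) ^ (-(1 / 2 : ℝ)) * s ^ (-(1 / 2 : ℝ))) (Ioo 0 t) := by
    refine Integrable.mono' hGi hmeas ?_
    filter_upwards [ae_restrict_mem measurableSet_Ioo] with s hs
    rw [Real.norm_of_nonneg (hnn s hs)]
    exact hdom s hs
  refine ⟨hint, ?_⟩
  -- the value of the dominating integral
  have hGval : ∫ s in Ioo 0 t, G s = a * (2 * t ^ (1 / 2 : ℝ) + 2 * (t - 0) ^ (1 / 2 : ℝ)) := by
    rw [hG, integral_const_mul, integral_add (integrableOn_rpow_neg_half_Ioo t)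
      (integrableOn_sub_rpow_Ioo (by norm_num)), setIntegral_Ioo_rpow_neg_half ht.le,
      setIntegral_Ioo_sub_rpow_neg_half ht.le]
  have hsqrt : t ^ (1 / 2 : ℝ) = Real.sqrt t := (Real.sqrt_eq_rpow t).symm
  have haval : a * Real.sqrt t = Real.sqrt 2 := by
    rw [ha, Real.rpow_neg (by positivity), ← Real.sqrt_eq_rpow, Real.sqrt_div' t zero_le_two]
    have hst : 0 < Real.sqrt t := Real.sqrt_pos.2 ht
    field_simp
  calc ∫ s in Ioo 0 t, (t - s) ^ (-(1 / 2 : ℝ)) * s ^ (-(1 / 2 : ℝ))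
      ≤ ∫ s in Ioo 0 t, G s := setIntegral_mono_on hint hGi measurableSet_Ioo hdom
    _ = 4 * (a * Real.sqrt t) := by rw [hGval, sub_zero, hsqrt]; ring
    _ = 4 * Real.sqrt 2 := by rw [haval]

/-- `√r/r² ≤ 2√2/(t√t)` for `r ≥ t/2 > 0` (the function `r ↦ r^{-3/2}` is decreasing). [folklore] -/
theorem sqrt_div_sq_le {t r : ℝ} (ht : 0 < t) (hr : t / 2 ≤ r) :
    Real.sqrt r / r ^ 2 ≤ 2 * Real.sqrt 2 / (t * Real.sqrt t) := by
  have hr0 : 0 < r := lt_of_lt_of_le (by positivity) hr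
  have hsr : 0 < Real.sqrt r := Real.sqrt_pos.2 hr0
  have hst : 0 < Real.sqrt t := Real.sqrt_pos.2 ht
  have hs2 : 0 < Real.sqrt 2 := Real.sqrt_pos.2 two_pos
  have hrr : Real.sqrt r * Real.sqrt r = r := Real.mul_self_sqrt hr0.le
  have htt : Real.sqrt t * Real.sqrt t = t := Real.mul_self_sqrt ht.le
  have h22 : Real.sqrt 2 * Real.sqrt 2 = 2 := Real.mul_self_sqrt zero_le_two
  -- `√(t/2) ≤ √r`, written as `√t ≤ √2 √r`
  have hcmp : Real.sqrt t ≤ Real.sqrt 2 * Real.sqrt r := by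
    rw [← Real.sqrt_mul zero_le_two]
    exact Real.sqrt_le_sqrt (by linarith)
  rw [div_le_div_iff₀ (by positivity) (by positivity)]
  -- goal: `√r * (t * √t) ≤ 2 * √2 * r ^ 2`
  have h1 : t * Real.sqrt t ≤ (2 * r) * (Real.sqrt 2 * Real.sqrt r) :=
    mul_le_mul (by linarith) hcmp hst.le (by positivity)
  calc Real.sqrt r * (t * Real.sqrt t) ≤ Real.sqrt r * ((2 * r) * (Real.sqrt 2 * Real.sqrt r)) :=
        mul_le_mul_of_nonneg_left h1 hsr.le
    _ = 2 * Real.sqrt 2 * r ^ 2 := by linear_combination (2 * Real.sqrt 2 * r) * hrr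

/-! ### The setting -/

section Setting

variable {v : ℝ → EuclideanSpace ℝ (Fin 3) → EuclideanSpace ℝ (Fin 3)}

/-- **Improvement of the planar bound.** In the setting of the module docstring, with the constant
`C₁` of `planarEnergy_le_of_oseenRepr`: if `v(0)` has planar energies `≤ ε²` and on `(0, τ]` the
slices have planar energies `≤ (2ε)²` and `√s ‖v(s)‖ ≤ η`, then for `0 < t ≤ τ` the planar energies of
`v(t)` are `≤ ((1 + 8√2 C₁ η) ε)²` (representation from the base time `0`,
`∫₀ᵗ (t−s)^{-1/2} s^{-1/2} ds ≤ 4√2`). [cite: KochNadirashviliSereginSverak2009, §4 p. 8] -/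
theorem improve_planar {C₁ : ℝ} (hC₁ : 0 < C₁)
    (hC₁spec : ∀ {w : ℝ → EuclideanSpace ℝ (Fin 3) → EuclideanSpace ℝ (Fin 3)},
      Measurable (uncurry w) → (∀ s, Continuous (w s)) → ∀ {t₀ t : ℝ}, t₀ < t →
      (∀ x, w t x = UnboundedOperators.heatExtension (w t₀) (t - t₀) x - oseenDuhamel 1 t₀ w w t x) →
      ∀ {χ₀ : ℝ}, 0 ≤ χ₀ →
      (∀ (R : EuclideanSpace ℝ (Fin 3) ≃ₗᵢ[ℝ] EuclideanSpace ℝ (Fin 3)) (c : ℝ),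
        ∫⁻ y : EuclideanSpace ℝ (Fin 2), ‖w t₀ (R (toLp 2 ![y 0, y 1, c]))‖ₑ ^ 2 ≤ ENNReal.ofReal (χ₀ ^ 2)) →
      ∀ {χ ψ : ℝ → ℝ}, (∀ s ∈ Ioo t₀ t, 0 ≤ χ s) →
      (∀ s ∈ Ioo t₀ t, ∀ (R : EuclideanSpace ℝ (Fin 3) ≃ₗᵢ[ℝ] EuclideanSpace ℝ (Fin 3)) (c : ℝ),
        ∫⁻ y : EuclideanSpace ℝ (Fin 2), ‖w s (R (toLp 2 ![y 0, y 1, c]))‖ₑ ^ 2 ≤ ENNReal.ofReal (χ s ^ 2)) →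
      (∀ s ∈ Ioo t₀ t, ∀ x, ‖w s x‖ ≤ ψ s) →
      IntegrableOn (fun s => (t - s) ^ (-(1 / 2 : ℝ)) * (ψ s * χ s)) (Ioo t₀ t) →
      ∀ (R : EuclideanSpace ℝ (Fin 3) ≃ₗᵢ[ℝ] EuclideanSpace ℝ (Fin 3)) (c : ℝ),
        ∫⁻ y : EuclideanSpace ℝ (Fin 2), ‖w t (R (toLp 2 ![y 0, y 1, c]))‖ₑ ^ 2 ≤
          ENNReal.ofReal ((χ₀ + C₁ * ∫ s in Ioo t₀ t, (t - s) ^ (-(1 / 2 : ℝ)) * (ψ s * χ s)) ^ 2))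
    (hvm : Measurable (uncurry v)) (hvs : ∀ s, Continuous (v s))
    {ε η τ : ℝ} (hε : 0 ≤ ε) (hη : 0 ≤ η)
    (hX0 : ∀ (R : EuclideanSpace ℝ (Fin 3) ≃ₗᵢ[ℝ] EuclideanSpace ℝ (Fin 3)) (c : ℝ),
      ∫⁻ y : EuclideanSpace ℝ (Fin 2), ‖v 0 (R (toLp 2 ![y 0, y 1, c]))‖ₑ ^ 2 ≤ ENNReal.ofReal (ε ^ 2))
    (hrep : ∀ t ∈ Ioc 0 τ, ∀ x,
      v t x = UnboundedOperators.heatExtension (v 0) (t - 0) x - oseenDuhamel 1 0 v v t x)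
    (hX : ∀ s ∈ Ioc 0 τ, ∀ (R : EuclideanSpace ℝ (Fin 3) ≃ₗᵢ[ℝ] EuclideanSpace ℝ (Fin 3)) (c : ℝ),
      ∫⁻ y : EuclideanSpace ℝ (Fin 2), ‖v s (R (toLp 2 ![y 0, y 1, c]))‖ₑ ^ 2 ≤ ENNReal.ofReal ((2 * ε) ^ 2))
    (hΦ : ∀ s ∈ Ioc 0 τ, ∀ x, Real.sqrt s * ‖v s x‖ ≤ η)
    {t : ℝ} (ht : t ∈ Ioc 0 τ) (R : EuclideanSpace ℝ (Fin 3) ≃ₗᵢ[ℝ] EuclideanSpace ℝ (Fin 3)) (c : ℝ) :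
    ∫⁻ y : EuclideanSpace ℝ (Fin 2), ‖v t (R (toLp 2 ![y 0, y 1, c]))‖ₑ ^ 2 ≤
      ENNReal.ofReal (((1 + 8 * Real.sqrt 2 * C₁ * η) * ε) ^ 2) := by
  have ht0 : 0 < t := ht.1
  obtain ⟨hBint, hBle⟩ := integrableOn_and_setIntegral_beta_le ht0
  -- the data of `planarEnergy_le_of_oseenRepr` from the base time `0`
  have hχ : ∀ s ∈ Ioo 0 t, (0 : ℝ) ≤ 2 * ε := fun _ _ => by positivity
  have hXs : ∀ s ∈ Ioo 0 t, ∀ (R : EuclideanSpace ℝ (Fin 3) ≃ₗᵢ[ℝ] EuclideanSpace ℝ (Fin 3)) (c : ℝ),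
      ∫⁻ y : EuclideanSpace ℝ (Fin 2), ‖v s (R (toLp 2 ![y 0, y 1, c]))‖ₑ ^ 2 ≤
        ENNReal.ofReal ((fun _ : ℝ => 2 * ε) s ^ 2) :=
    fun s hs => hX s ⟨hs.1, hs.2.le.trans ht.2⟩
  have hψ : ∀ s ∈ Ioo 0 t, ∀ x, ‖v s x‖ ≤ (fun s : ℝ => η * s ^ (-(1 / 2 : ℝ))) s := by
    intro s hs x
    have hs0 : 0 < s := hs.1
    have hss : 0 < Real.sqrt s := Real.sqrt_pos.2 hs0
    have h := hΦ s ⟨hs.1, hs.2.le.trans ht.2⟩ x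
    have hrw : s ^ (-(1 / 2 : ℝ)) = (Real.sqrt s)⁻¹ := by
      rw [Real.rpow_neg hs0.le, ← Real.sqrt_eq_rpow]
    show ‖v s x‖ ≤ η * s ^ (-(1 / 2 : ℝ))
    rw [hrw, le_mul_inv_iff₀ hss, mul_comm]
    exact h
  have hint : IntegrableOn (fun s => (t - s) ^ (-(1 / 2 : ℝ)) *
      ((fun s : ℝ => η * s ^ (-(1 / 2 : ℝ))) s * (fun _ : ℝ => 2 * ε) s)) (Ioo 0 t) := by
    have h : IntegrableOn (fun s => η * (2 * ε) * ((t - s) ^ (-(1 / 2 : ℝ)) * s ^ (-(1 / 2 : ℝ))))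
        (Ioo 0 t) := hBint.const_mul (η * (2 * ε))
    refine IntegrableOn.congr_fun h (fun s _ => ?_) measurableSet_Ioo
    simp only
    ring
  have hmain := hC₁spec hvm hvs ht0 (hrep t ht) hε hX0 hχ hXs hψ hint R c
  refine hmain.trans (ENNReal.ofReal_le_ofReal ?_)
  -- compare the two squares
  have hJ : ∫ s in Ioo 0 t, (t - s) ^ (-(1 / 2 : ℝ)) *
      ((fun s : ℝ => η * s ^ (-(1 / 2 : ℝ))) s * (fun _ : ℝ => 2 * ε) s) ≤ η * (2 * ε) * (4 * Real.sqrt 2) := by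
    have heq : (fun s => (t - s) ^ (-(1 / 2 : ℝ)) *
        ((fun s : ℝ => η * s ^ (-(1 / 2 : ℝ))) s * (fun _ : ℝ => 2 * ε) s)) =
        fun s => η * (2 * ε) * ((t - s) ^ (-(1 / 2 : ℝ)) * s ^ (-(1 / 2 : ℝ))) := by
      funext s; ring
    rw [heq, integral_const_mul]
    exact mul_le_mul_of_nonneg_left hBle (by positivity)
  have hJ0 : 0 ≤ ∫ s in Ioo 0 t, (t - s) ^ (-(1 / 2 : ℝ)) *
      ((fun s : ℝ => η * s ^ (-(1 / 2 : ℝ))) s * (fun _ : ℝ => 2 * ε) s) := by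
    refine setIntegral_nonneg measurableSet_Ioo fun s hs => ?_
    have h1 : 0 ≤ (t - s) ^ (-(1 / 2 : ℝ)) := Real.rpow_nonneg (sub_pos.2 hs.2).le _
    have h2 : 0 ≤ s ^ (-(1 / 2 : ℝ)) := Real.rpow_nonneg hs.1.le _
    simp only
    positivity
  have hle : ε + C₁ * ∫ s in Ioo 0 t, (t - s) ^ (-(1 / 2 : ℝ)) *
      ((fun s : ℝ => η * s ^ (-(1 / 2 : ℝ))) s * (fun _ : ℝ => 2 * ε) s) ≤ (1 + 8 * Real.sqrt 2 * C₁ * η) * ε := by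
    have := mul_le_mul_of_nonneg_left hJ hC₁.le
    nlinarith
  have hnn : 0 ≤ ε + C₁ * ∫ s in Ioo 0 t, (t - s) ^ (-(1 / 2 : ℝ)) *
      ((fun s : ℝ => η * s ^ (-(1 / 2 : ℝ))) s * (fun _ : ℝ => 2 * ε) s) := by positivity
  exact pow_le_pow_left₀ hnn hle 2

/-- **Improvement of the velocity bound.** With the constant `K` of
`exists_norm_oseenSlice_le_of_morrey`: if `v(0)` has planar energies `≤ ε²` and on `(0, τ]` the
slices have planar energies `≤ (2ε)²` and `√s ‖v(s)‖ ≤ η`, then for `0 < t ≤ τ`,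
`√t ‖v(t,x)‖ ≤ A_h ε + 16√2 K ε² + 4 C₀ η²` with `A_h = 2048 (4π)^{-3/2} √(2V₁)`, `C₀` the KNSS slice
constant (representation from the base time `0`; the Morrey slice bound on `(0, t/2]`, the sup slice
bound on `(t/2, t)`). [cite: KochNadirashviliSereginSverak2009, §3 (3.8), §4 p. 8] -/
theorem improve_sup {K : ℝ} (hK : 0 < K)
    (hKspec : ∀ {a : EuclideanSpace ℝ (Fin 3) → EuclideanSpace ℝ (Fin 3)} {τ I : ℝ}, 0 < τ → 0 ≤ I →
      (∀ (y : EuclideanSpace ℝ (Fin 3)) (r : ℝ), 0 < r →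
        ∫⁻ z in ball y r, ‖a z‖ₑ ^ 2 ≤ ENNReal.ofReal (I * r)) →
      ∀ x, ‖oseenSlice τ a a x‖ ≤ K * I * (Real.sqrt τ / τ ^ 2))
    (hvs : ∀ s, Continuous (v s))
    {ε η τ : ℝ} (hε : 0 ≤ ε)
    (hX0 : ∀ (R : EuclideanSpace ℝ (Fin 3) ≃ₗᵢ[ℝ] EuclideanSpace ℝ (Fin 3)) (c : ℝ),
      ∫⁻ y : EuclideanSpace ℝ (Fin 2), ‖v 0 (R (toLp 2 ![y 0, y 1, c]))‖ₑ ^ 2 ≤ ENNReal.ofReal (ε ^ 2))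
    (hrep : ∀ t ∈ Ioc 0 τ, ∀ x,
      v t x = UnboundedOperators.heatExtension (v 0) (t - 0) x - oseenDuhamel 1 0 v v t x)
    (hX : ∀ s ∈ Ioc 0 τ, ∀ (R : EuclideanSpace ℝ (Fin 3) ≃ₗᵢ[ℝ] EuclideanSpace ℝ (Fin 3)) (c : ℝ),
      ∫⁻ y : EuclideanSpace ℝ (Fin 2), ‖v s (R (toLp 2 ![y 0, y 1, c]))‖ₑ ^ 2 ≤ ENNReal.ofReal ((2 * ε) ^ 2))
    (hΦ : ∀ s ∈ Ioc 0 τ, ∀ x, Real.sqrt s * ‖v s x‖ ≤ η)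
    {t : ℝ} (ht : t ∈ Ioc 0 τ) (x : EuclideanSpace ℝ (Fin 3)) :
    Real.sqrt t * ‖v t x‖ ≤
      2048 * (4 * Real.pi) ^ (-(3 : ℝ) / 2) *
          Real.sqrt (2 * (volume (ball (0 : EuclideanSpace ℝ (Fin 3)) 1)).toReal) * ε +
        16 * Real.sqrt 2 * K * ε ^ 2 + 4 * oseenSliceConst (EuclideanSpace ℝ (Fin 3)) * η ^ 2 := by
  set C₀ : ℝ := oseenSliceConst (EuclideanSpace ℝ (Fin 3)) with hC₀
  have hC₀pos : 0 < C₀ := oseenSliceConst_pos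
  set V₁ : ℝ := (volume (ball (0 : EuclideanSpace ℝ (Fin 3)) 1)).toReal with hV₁
  have hV₁0 : 0 ≤ V₁ := ENNReal.toReal_nonneg
  have ht0 : 0 < t := ht.1
  have hst : 0 < Real.sqrt t := Real.sqrt_pos.2 ht0
  -- the majorant `g(s) = 16√2 K ε²/(t√t) + (2C₀η²/t)(t−s)^{-1/2}`
  set A : ℝ := 16 * Real.sqrt 2 * K * ε ^ 2 / (t * Real.sqrt t) with hA
  have hA0 : 0 ≤ A := by positivity
  set g : ℝ → ℝ := fun s => A + (2 * C₀ * η ^ 2 / t) * (t - s) ^ (-(1 / 2 : ℝ)) with hg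
  have hgi : IntegrableOn g (Ioo 0 t) := by
    have h1 : IntegrableOn (fun _ : ℝ => A) (Ioo 0 t) := integrableOn_const (by simp)
    exact h1.add ((integrableOn_sub_rpow_Ioo (by norm_num)).const_mul _)
  have hgval : ∫ s in Ioo 0 t, g s = A * t + (2 * C₀ * η ^ 2 / t) * (2 * t ^ (1 / 2 : ℝ)) := by
    have h1 : IntegrableOn (fun _ : ℝ => A) (Ioo 0 t) := integrableOn_const (by simp)
    rw [hg, integral_add h1 ((integrableOn_sub_rpow_Ioo (by norm_num)).const_mul _),
      setIntegral_const, integral_const_mul, setIntegral_Ioo_sub_rpow_neg_half ht0.le, sub_zero]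
    simp only [smul_eq_mul, measureReal_def, Real.volume_Ioo, sub_zero, ENNReal.toReal_ofReal ht0.le]
    ring
  -- `g` dominates the slice norms
  have hslice : ∀ s ∈ Ioo 0 t, ∀ y, ‖oseenSlice (t - s) (v s) (v s) y‖ ≤ g s := by
    intro s hs y
    have hs0 : 0 < s := hs.1
    have hts : 0 < t - s := sub_pos.2 hs.2
    have hsmem : s ∈ Ioc 0 τ := ⟨hs.1, hs.2.le.trans ht.2⟩
    have hterm2 : 0 ≤ (2 * C₀ * η ^ 2 / t) * (t - s) ^ (-(1 / 2 : ℝ)) :=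
      mul_nonneg (by positivity) (Real.rpow_nonneg hts.le _)
    rcases le_or_gt s (t / 2) with hle | hgt
    · -- Morrey bound on the first half
      have hM := norm_oseenSlice_le_of_planar hKspec (hvs s) (hX s hsmem) hts y
      have hcmp : Real.sqrt (t - s) / (t - s) ^ 2 ≤ 2 * Real.sqrt 2 / (t * Real.sqrt t) :=
        sqrt_div_sq_le ht0 (by linarith)
      calc ‖oseenSlice (t - s) (v s) (v s) y‖ ≤ K * (2 * (2 * ε) ^ 2) * (Real.sqrt (t - s) / (t - s) ^ 2) := hM
        _ ≤ K * (2 * (2 * ε) ^ 2) * (2 * Real.sqrt 2 / (t * Real.sqrt t)) :=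
            mul_le_mul_of_nonneg_left hcmp (by positivity)
        _ = A := by rw [hA]; field_simp; ring
        _ ≤ g s := by rw [hg]; linarith
    · -- sup bound on the second half
      have hsq : 0 < Real.sqrt s := Real.sqrt_pos.2 hs0
      have hψs : ∀ z, ‖v s z‖ ≤ η / Real.sqrt s := fun z => by
        rw [le_div_iff₀ hsq, mul_comm]; exact hΦ s hsmem z
      have hS := norm_oseenSlice_le_of_bound (w := v) hs.2 hψs y
      have h2s : 1 / s ≤ 2 / t := by
        rw [div_le_div_iff₀ hs0 ht0]; linarith
      calc ‖oseenSlice (t - s) (v s) (v s) y‖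
          ≤ C₀ * (t - s) ^ (-(1 / 2 : ℝ)) * (η / Real.sqrt s) * (η / Real.sqrt s) := hS
        _ = C₀ * η ^ 2 * (1 / s) * (t - s) ^ (-(1 / 2 : ℝ)) := by
            field_simp
            rw [Real.sq_sqrt hs0.le]
            ring
        _ ≤ C₀ * η ^ 2 * (2 / t) * (t - s) ^ (-(1 / 2 : ℝ)) := by
            have h1 : 0 ≤ (t - s) ^ (-(1 / 2 : ℝ)) := Real.rpow_nonneg hts.le _
            gcongr
        _ = (2 * C₀ * η ^ 2 / t) * (t - s) ^ (-(1 / 2 : ℝ)) := by ring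
        _ ≤ g s := by rw [hg]; linarith
  -- the velocity inequality from the base time `0`
  have hmain := norm_le_of_oseenRepr (w := v) ht0 (hvs 0) (hrep t ht) hX0 hslice hgi x
  rw [sub_zero] at hmain
  -- bookkeeping: multiply by `√t`
  have hsq2 : Real.sqrt (V₁ * (2 * ε ^ 2)) = Real.sqrt (2 * V₁) * ε := by
    rw [show V₁ * (2 * ε ^ 2) = (2 * V₁) * ε ^ 2 by ring, Real.sqrt_mul (by positivity), Real.sqrt_sq hε]
  have htt : Real.sqrt t * Real.sqrt t = t := Real.mul_self_sqrt ht0.le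
  have hAt : Real.sqrt t * (A * t) = 16 * Real.sqrt 2 * K * ε ^ 2 := by
    rw [hA]
    field_simp
  have hlate : Real.sqrt t * ((2 * C₀ * η ^ 2 / t) * (2 * t ^ (1 / 2 : ℝ))) = 4 * C₀ * η ^ 2 := by
    rw [← Real.sqrt_eq_rpow]
    field_simp
    nlinarith [htt, hst]
  have hheat : Real.sqrt t * (2048 * (4 * Real.pi) ^ (-(3 : ℝ) / 2) * Real.sqrt (V₁ * (2 * ε ^ 2)) /
      Real.sqrt t) = 2048 * (4 * Real.pi) ^ (-(3 : ℝ) / 2) * Real.sqrt (2 * V₁) * ε := by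
    rw [hsq2]
    field_simp
  calc Real.sqrt t * ‖v t x‖
      ≤ Real.sqrt t * (2048 * (4 * Real.pi) ^ (-(3 : ℝ) / 2) * Real.sqrt (V₁ * (2 * ε ^ 2)) / Real.sqrt t +
          ∫ s in Ioo 0 t, g s) := mul_le_mul_of_nonneg_left hmain hst.le
    _ = Real.sqrt t * (2048 * (4 * Real.pi) ^ (-(3 : ℝ) / 2) * Real.sqrt (V₁ * (2 * ε ^ 2)) / Real.sqrt t) +
          (Real.sqrt t * (A * t) + Real.sqrt t * ((2 * C₀ * η ^ 2 / t) * (2 * t ^ (1 / 2 : ℝ)))) := by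
        rw [hgval]; ring
    _ = 2048 * (4 * Real.pi) ^ (-(3 : ℝ) / 2) * Real.sqrt (2 * V₁) * ε +
          (16 * Real.sqrt 2 * K * ε ^ 2 + 4 * C₀ * η ^ 2) := by rw [hheat, hAt, hlate]
    _ = _ := by ring

end Setting

/-! ### Registered form -/

/-- **The Beta-type bound, closed form** (registered sub-goal of stmt-NavierStokesRegularity-16855):
`∫₀ᵗ (t−s)^{-1/2} s^{-1/2} ds ≤ 4√2` for `t > 0`. [folklore] -/
theorem setIntegral_beta_le_closedForm :
    ∀ t : ℝ, 0 < t → ∫ s in Set.Ioo 0 t, (t - s) ^ (-(1 / 2 : ℝ)) * s ^ (-(1 / 2 : ℝ)) ≤ 4 * Real.sqrt 2 :=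
  fun _ ht => (integrableOn_and_setIntegral_beta_le ht).2

end Summit.NavierStokesRegularity.NavierStokesRegularity.Theorems.PlanarEnergyAPriori.SmallData

end
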